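import Summits.QuantumFields.QCD.Theorems.RobustYangMills.Negative.NoSmallFalse
import Literature.MathematicalPhysics.QuantumFieldTheory.QuasiLocalGaugePerturbationWilson

/-!
# `RobustYangMills` — the coupling-shift direction is admissible; clause (iv) read on pure Wilson
theory: β-Lipschitz continuity of ALL renormalised raw lattice moments at slope `C · 288 e^{3κ} b_k⁴`

Standing disprover (`cdisprove`, gen 2) for the shared crux
`Summit.QuantumFields.QCD.Theses.NestedDissectionSea.RobustYangMills` (item stmt-QuantumFields-13897,
rev 4; verbatim `HeavyThresholdYMBridge.RobustYangMills`, `AdaptiveBlockFermions.RobustYangMills`).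

* §1 `(h4)` **range control of plaquette support polymers**: the (at most three) block corners of the
  base points of a plaquette differ coordinatewise by at most `b` one way round the torus
  (`corner_succ_sub_val_le`, `rangeControl_plaquetteSupport`), so the tree's Wilson perturbation
  `t • QuasiLocalGaugePerturbation.wilson ρ hρ b` passes the crux's clause (h4) (`rangeControl_smul_wilson`).
* §2 the coupling shift `t • wilson` passes (h1) (lattice symmetries of `t · S_W`), (h2) (its perturbed
  measure is Wilson's at `β + t ≥ 0`, reflection positive on odd tori) and (h3) with budget
  `t · 288 e^{3κ} b⁴` (`normLE_smul_wilson_su3`, from the tree's volume-uniform `normLE_smul_wilson`).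
* §3 **`robustYangMills_imp_betaLipschitz`**: feeding `W ≡ 0` to the crux and comparing, in clause (iv),
  with `W' = t • wilson` (`δ = t · 288 e^{3κ} b_k⁴ ≤ η`) shows that the crux asserts, for the SAME witness
  `(φ, c, m, T, Δ)` that carries the Clay-type conclusions of `robustYangMills_imp_wilson`, the bound
  `|𝔐_k(β'_k) − 𝔐_k(β'_k + t)| ≤ C_{n,σ,f} · 288 e^{3κ} ⌊ℓ₀/a_k⌋⁴ · t` for `0 ≤ t ≤ η /(288 e^{3κ} ⌊ℓ₀/a_k⌋⁴)`,
  eventually in `k`, for EVERY arity `n`, species string `σ` and smearing `f` — coincident smearings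
  included — where `𝔐_k(β)` is the renormalised raw lattice moment `∫ ∏ᵢ Φ^{σᵢ}(fᵢ) dμ_{2L_k+1, β}` with
  the witness's renormalisations `(c, m)` (`WilsonBetaLipschitz`).

**Why this matters (near-miss, class `misstated`, not Lean-refutable today).** With the canonical
normalisation `c_k ≍ a_k⁻⁴ g_k⁻²` that non-triviality of the limit two-point function is expected to force,
the raw third moment at a repeated smearing, `𝔐_k = ⟨Φ(f)³⟩`, responds to `β ↦ β + t` through the
additive-counterterm mismatch `Φ ↦ Φ + c_k ∫f · t ∂_β⟨s̃⟩` times the DIVERGENT coincident variance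
`Var Φ(f) ≍ a_k⁻⁴ ‖f‖₂²`: `∂_t ⟨Φ(f)³⟩ ∋ 3 Var(Φf) · c_k ∫f ∂_β⟨s̃⟩ ≍ a_k⁻⁸ g_k²`, against the slope
`≍ a_k⁻⁴ ℓ₀⁴` allowed here (`n ≤ 2` and all `⁰𝒮` smearings pass). Turning this into `¬ RobustYangMills`
needs the weak-coupling UV scaling of `c_k`, i.e. `|⟨s̃_0 ; s̃_x⟩_{β'_k}| ≲ |x|⁻⁴` uniformly in `k`
(nonperturbative control of 4-d `SU(3)`), which the crux's own clauses do not supply: (iii′) decays at the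
PHYSICAL rate only (`C e^{-Δ a_k n} = O(1)` at physical separation) and non-triviality with `|Cov| ≤ ‖s̃‖²`
pins only `liminf |c_k| > 0`. Repair recorded for the planners: restrict (iv) to `⁰𝒮` smearings exactly as
(i′) (or to bounded un-renormalised cylinder observables, or to truncated moments).
-/

noncomputable section

open MeasureTheory Filter Topology Finset
open scoped ENNReal ComplexOrder
open Literature.MathematicalPhysics.QuantumLattice Literature.MathematicalPhysics.AQFT
  Literature.MathematicalPhysics.QuantumFieldTheory

namespace Summit.QuantumFields.QCD.Theorems.RobustYangMills.Negative

/-! ## §1 Range control (h4) of the plaquette support polymers -/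

section Corners

variable {d L : ℕ} [NeZero L] {b : ℕ}

/-- One lattice step moves the block corner coordinate by at most `b`, one way round the torus:
`val (⌊(v+1)/b⌋ b − ⌊v/b⌋ b) ≤ b` in `ℤ/L` (also across the seam `v = L - 1`). [folklore] -/
theorem corner_succ_sub_val_le (hb : 0 < b) (v : ZMod L) :
    ((((v + 1).val / b * b : ℕ) : ZMod L) - ((v.val / b * b : ℕ) : ZMod L)).val ≤ b := by
  have hL : 0 < L := Nat.pos_of_ne_zero (NeZero.ne L)
  have hmL : v.val < L := ZMod.val_lt v
  have hv1 : (v + 1).val = (v.val + 1) % L := by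
    have : v + 1 = ((v.val + 1 : ℕ) : ZMod L) := by
      rw [Nat.cast_add, Nat.cast_one, ZMod.natCast_zmod_val]
    rw [this, ZMod.val_natCast]
  -- abstract the two corner coordinates as naturals `q ≤ q'`
  obtain ⟨q, hq_eq, hq1, hq2⟩ : ∃ q : ℕ, v.val / b * b = q ∧ q ≤ v.val ∧ v.val < q + b :=
    ⟨_, rfl, Nat.div_mul_le_self _ _, Nat.lt_div_mul_add hb⟩
  have hmono : v.val / b * b ≤ (v.val + 1) / b * b :=
    Nat.mul_le_mul_right _ (Nat.div_le_div_right (Nat.le_succ _))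
  obtain ⟨q', hq'_eq, hq'1, hq'2⟩ : ∃ q' : ℕ, (v.val + 1) / b * b = q' ∧ q' ≤ v.val + 1 ∧ q ≤ q' :=
    ⟨_, rfl, Nat.div_mul_le_self _ _, by rw [← hq_eq]; exact hmono⟩
  rcases Nat.lt_or_ge (v.val + 1) L with h | h
  · rw [hv1, Nat.mod_eq_of_lt h, hq'_eq, hq_eq, ← Nat.cast_sub hq'2, ZMod.val_natCast]
    exact (Nat.mod_le _ _).trans (by omega)
  · have hmL' : v.val + 1 = L := le_antisymm hmL h
    rw [hv1, hmL', Nat.mod_self, Nat.zero_div, zero_mul, Nat.cast_zero, zero_sub, ZMod.neg_val',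
      hq_eq, ZMod.val_natCast, Nat.mod_eq_of_lt (by omega : q < L)]
    exact (Nat.mod_le _ _).trans (by omega)

omit [NeZero L] in
/-- Away from the shifted coordinate the block corner does not move. [folklore] -/
theorem blockCorner_shift_apply_of_ne (x : Site d L) {j i : Fin d} (hij : i ≠ j) :
    blockCorner b (x.shift j) i = blockCorner b x i := by
  have : (x.shift j) i = x i := by simp [Site.shift, hij]
  simp only [blockCorner, this]

/-- The block corners of `x + eⱼ` and `x` differ coordinatewise by at most `b` (one-sided). [folklore] -/
theorem blockCorner_shift_sub_val_le (hb : 0 < b) (x : Site d L) (j i : Fin d) :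
    (blockCorner b (x.shift j) i - blockCorner b x i).val ≤ b := by
  by_cases hij : i = j
  · subst hij
    have : (x.shift i) i = x i + 1 := by simp [Site.shift]
    simp only [blockCorner, this]
    exact corner_succ_sub_val_le hb (x i)
  · rw [blockCorner_shift_apply_of_ne x hij, sub_self, ZMod.val_zero]
    exact Nat.zero_le _

/-- The block corners of `x + eⱼ` and `x + eₗ` differ coordinatewise by at most `b`, one way or the
other. [folklore] -/
theorem blockCorner_shift_pair (hb : 0 < b) (x : Site d L) (j l i : Fin d) :
    (blockCorner b (x.shift j) i - blockCorner b (x.shift l) i).val ≤ b ∨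
      (blockCorner b (x.shift l) i - blockCorner b (x.shift j) i).val ≤ b := by
  by_cases hij : i = j
  · by_cases hil : i = l
    · left
      rw [← hij, ← hil, sub_self, ZMod.val_zero]
      exact Nat.zero_le _
    · left
      rw [blockCorner_shift_apply_of_ne x hil]
      exact blockCorner_shift_sub_val_le hb x j i
  · right
    rw [blockCorner_shift_apply_of_ne x hij]
    exact blockCorner_shift_sub_val_le hb x l i

/-- **(h4) for plaquette supports**: any two of the (at most three) corners of `plaquetteSupport b p`
differ in every coordinate by at most `b`, one way round the torus or the other. [folklore] -/
theorem rangeControl_plaquetteSupport (hb : 0 < b) (p : Plaquette d L) (y : Site d L)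
    (hy : y ∈ plaquetteSupport b p) (y' : Site d L) (hy' : y' ∈ plaquetteSupport b p) (i : Fin d) :
    (y i - y' i).val ≤ b ∨ (y' i - y i).val ≤ b := by
  have h0 : ∀ z : Site d L, (z i - z i).val ≤ b ∨ (z i - z i).val ≤ b := fun z =>
    Or.inl (by rw [sub_self, ZMod.val_zero]; exact Nat.zero_le _)
  simp only [plaquetteSupport, Finset.mem_insert, Finset.mem_singleton] at hy hy'
  rcases hy with rfl | rfl | rfl <;> rcases hy' with rfl | rfl | rfl
  · exact h0 (blockCorner b p.1)
  · exact Or.inr (blockCorner_shift_sub_val_le hb p.1 p.2.1.1 i)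
  · exact Or.inr (blockCorner_shift_sub_val_le hb p.1 p.2.1.2 i)
  · exact Or.inl (blockCorner_shift_sub_val_le hb p.1 p.2.1.1 i)
  · exact h0 (blockCorner b (p.1.shift p.2.1.1))
  · exact blockCorner_shift_pair hb p.1 p.2.1.1 p.2.1.2 i
  · exact Or.inl (blockCorner_shift_sub_val_le hb p.1 p.2.1.2 i)
  · exact blockCorner_shift_pair hb p.1 p.2.1.2 p.2.1.1 i
  · exact h0 (blockCorner b (p.1.shift p.2.1.2))

end Corners

/-! ## §2 The coupling shift `t • wilson` passes (h1)–(h4) -/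

section Shift

variable {G : Type} [Group G] [TopologicalSpace G] [IsTopologicalGroup G] [CompactSpace G]
  [MeasurableSpace G] [BorelSpace G] [SecondCountableTopology G] {N : ℕ}
  (ρ : G →* Matrix (Fin N) (Fin N) ℂ) (hρ : Continuous ρ)

/-- **(h4) for the coupling shift**: the activities of `t • wilson` live on plaquette supports. [folklore] -/
theorem rangeControl_smul_wilson {d L : ℕ} [NeZero L] {b : ℕ} (hb : 0 < b) (t : ℝ)
    (X : Finset (Site d L))
    (hne : ∃ U : GaugeConfig d L G, (t • QuasiLocalGaugePerturbation.wilson ρ hρ b).act X U ≠ 0)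
    (y : Site d L) (hy : y ∈ X) (y' : Site d L) (hy' : y' ∈ X) (i : Fin d) :
    (y i - y' i).val ≤ b * X.card ∨ (y' i - y i).val ≤ b * X.card := by
  obtain ⟨U, hU⟩ := hne
  rw [QuasiLocalGaugePerturbation.smul_act, QuasiLocalGaugePerturbation.wilson_act] at hU
  have hX : ∃ p : Plaquette d L, plaquetteSupport b p = X := by
    by_contra h
    push Not at h
    apply hU
    rw [Finset.filter_false_of_mem (fun p _ => h p), Finset.sum_empty, mul_zero]
  obtain ⟨p, rfl⟩ := hX
  have hcard : 0 < (plaquetteSupport b p).card := Finset.card_pos.2 ⟨y, hy⟩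
  have hbb : b ≤ b * (plaquetteSupport b p).card := Nat.le_mul_of_pos_right _ hcard
  exact (rangeControl_plaquetteSupport hb p y hy y' hy' i).imp (fun h => h.trans hbb) fun h => h.trans hbb

variable {Lt : ℕ} [NeZero Lt]

/-- The total of `t • wilson` is `t · S_W`. [folklore] -/
theorem total_smul_wilson_apply (b : ℕ) (t : ℝ) (U : GaugeConfig 4 Lt G) :
    (t • QuasiLocalGaugePerturbation.wilson ρ hρ b).total U = t * wilsonAction ρ U := by
  rw [QuasiLocalGaugePerturbation.total_smul, QuasiLocalGaugePerturbation.total_wilson]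
  rfl

/-- (h1a) for the coupling shift. [folklore] -/
theorem total_smul_wilson_shift (b : ℕ) (t : ℝ) (v : Site 4 Lt) (U : GaugeConfig 4 Lt G) :
    (t • QuasiLocalGaugePerturbation.wilson ρ hρ b).total (torusConfigShift v U) =
      (t • QuasiLocalGaugePerturbation.wilson ρ hρ b).total U := by
  rw [total_smul_wilson_apply, total_smul_wilson_apply, wilsonAction_torusConfigShift]

/-- (h1b) for the coupling shift. [folklore] -/
theorem total_smul_wilson_timeReflect (b : ℕ) (t : ℝ) (U : GaugeConfig 4 Lt G) :
    (t • QuasiLocalGaugePerturbation.wilson ρ hρ b).total (GaugeConfig.timeReflect U) =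
      (t • QuasiLocalGaugePerturbation.wilson ρ hρ b).total U := by
  rw [total_smul_wilson_apply, total_smul_wilson_apply, wilsonAction_timeReflect ρ hρ]

/-- (h1c) for the coupling shift. [folklore] -/
theorem total_smul_wilson_perm (b : ℕ) (t : ℝ) (π : Equiv.Perm (Fin 4)) (U : GaugeConfig 4 Lt G) :
    (t • QuasiLocalGaugePerturbation.wilson ρ hρ b).total (fun e => U (e.1 ∘ π, π.symm e.2)) =
      (t • QuasiLocalGaugePerturbation.wilson ρ hρ b).total U := by
  rw [← configPerm_eq, total_smul_wilson_apply, total_smul_wilson_apply, wilsonAction_configPerm ρ hρ]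

/-- **(h2) for the coupling shift**: `μ_{β, t • wilson} = μ_{β + t}` is reflection positive on the odd
torus `2S+1`, `S ≥ 1`, as soon as `β + t ≥ 0` (tree: Osterwalder–Seiler odd-torus positivity). [folklore] -/
theorem isReflectionPositive_smul_wilson {S : ℕ} (hS : 1 ≤ S) (b : ℕ) {β t : ℝ} (hβt : 0 ≤ β + t) :
    (t • QuasiLocalGaugePerturbation.wilson (d := 4) (L := 2 * S + 1) ρ hρ b).IsReflectionPositive ρ β := by
  intro F hF hFb hFpos
  rw [QuasiLocalGaugePerturbation.expectation_smul_wilson]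
  exact wilsonExpectation_oddRP ρ hS hρ hβt F hF hFb hFpos

end Shift

/-! ## §3 `G = SU(3)`: the crux read on the Wilson theory in the β-direction -/

section SU3Shift

/-- The fundamental representation of `SU(3)` is unitary. [folklore] -/
theorem ρ₃_mem_unitary : ∀ g : SU3, ρ₃ g ∈ Matrix.unitaryGroup (Fin 3) ℂ :=
  fundamentalRep_mem_unitaryGroup

/-- **(h3) for the coupling shift at `SU(3)`, `d = 4`**: `‖t • wilson‖_{b,κ} ≤ t · 288 e^{3κ} b⁴`
for `t ≥ 0`, `κ ≥ 0`, `b ≥ 1` (the tree's `|t| · 2N e^{3κ} · 3 d² b^d`). [folklore] -/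
theorem normLE_smul_wilson_su3 {Lt : ℕ} [NeZero Lt] {κ : ℝ} (hκ : 0 ≤ κ) {b : ℕ} (hb : 0 < b)
    {t : ℝ} (ht : 0 ≤ t) :
    (t • QuasiLocalGaugePerturbation.wilson (d := 4) (L := Lt) ρ₃ continuous_ρ₃ b).NormLE κ
      (t * (288 * Real.exp (3 * κ) * (b : ℝ) ^ 4)) := by
  refine (QuasiLocalGaugePerturbation.normLE_smul_wilson ρ₃ continuous_ρ₃ ρ₃_mem_unitary hκ hb t).mono
    (le_of_eq ?_)
  rw [abs_of_nonneg ht]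
  push_cast
  ring

/-- **`WilsonConsequences` plus the β-Lipschitz reading of clause (iv)** for the data `(a, L, β')`, the
block scale `ℓ₀`, the decay `κ` and the budget `η`: ONE witness `(φ, c, m, T, Δ)` with the subsequential
OS limit of the pure `SU(3)` Wilson theory on `⁰𝒮`, non-trivial non-Gaussian curvature, `HasMassGap Δ`,
the uniform lattice gap `HasLatticeMassGap … Δ`, AND: for every `(n, σ, f)` a `k`-uniform `C` with
`|𝔐_k(β'_k) − 𝔐_k(β'_k + t)| ≤ C · t · 288 e^{3κ} ⌊ℓ₀/a_k⌋⁴` for all `0 ≤ t` with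
`t · 288 e^{3κ} ⌊ℓ₀/a_k⌋⁴ ≤ η`, eventually in `k`, where `𝔐_k(β)` is the renormalised raw lattice moment
at coupling `β` with the witness's `(c, m)` (the tree's `latticeSchwinger` of the scheme with `β'`
replaced by `β' + t`). -/
def WilsonBetaLipschitz (κ η : ℝ) (a : ℕ → ℝ) (L : ℕ → ℕ) (ha : ∀ k, 0 < a k)
    (ha₀ : Filter.Tendsto a Filter.atTop (nhds 0))
    (haL : Filter.Tendsto (fun k => a k * L k) Filter.atTop Filter.atTop) (β' : ℕ → ℝ) (ℓ₀ : ℝ) : Prop :=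
  let r₃ : LatticeRep SU3 := ⟨3, ρ₃, continuous_fundamentalRep _, fundamentalRep_injective _, fundamentalRep_mem_unitaryGroup⟩;
  ∃ φ : ℕ → ℕ, StrictMono φ ∧ ∃ (c m : YMSpecies SU3 → ℕ → ℝ) (T : OSData (YMSpecies SU3) 4) (Δ : ℝ),
    0 < Δ ∧
    (∀ n : ℕ, n ≠ 0 → ∀ (σ : Fin n → YMSpecies SU3) (f : Fin n → SchwartzMap (EuclideanSpace ℝ (Fin 4)) ℝ)
      (F : SchwartzMap (Fin n → EuclideanSpace ℝ (Fin 4)) ℂ),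
      IsTensorOf F (fun i => ofRealTest (f i)) → IsOffDiagonal F →
        Filter.Tendsto (fun j : ℕ => ((latticeSchwinger ρ₃
          (⟨a, ha, ha₀, β', L, haL, c, m⟩ : SpeciesScheme (YMSpecies SU3)) (fun s => s.F) (φ j) n σ f : ℝ) : ℂ))
          Filter.atTop (nhds (T.schwinger n σ F))) ∧
    T.IsNontrivial r₃.curvature ∧ T.IsNonGaussian r₃.curvature ∧ T.HasMassGap Δ ∧
    HasLatticeMassGap r₃ (⟨a, ha, ha₀, β', L, haL, c, m⟩ : SpeciesScheme (YMSpecies SU3)) Δ ∧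
    ∀ (n : ℕ) (σ : Fin n → YMSpecies SU3) (f : Fin n → SchwartzMap (EuclideanSpace ℝ (Fin 4)) ℝ),
      ∃ C : ℝ, ∀ᶠ k in Filter.atTop, ∀ t : ℝ, 0 ≤ t →
        t * (288 * Real.exp (3 * κ) * (⌊ℓ₀ / a k⌋₊ : ℝ) ^ 4) ≤ η →
          |latticeSchwinger ρ₃ (⟨a, ha, ha₀, β', L, haL, c, m⟩ : SpeciesScheme (YMSpecies SU3))
              (fun s => s.F) k n σ f -
            latticeSchwinger ρ₃ (⟨a, ha, ha₀, fun k => β' k + t, L, haL, c, m⟩ : SpeciesScheme (YMSpecies SU3))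
              (fun s => s.F) k n σ f| ≤
          C * (t * (288 * Real.exp (3 * κ) * (⌊ℓ₀ / a k⌋₊ : ℝ) ^ 4))

/-- **The crux read on the pure Wilson theory in the β-direction.** If `RobustYangMills` holds with
constants `(η₀, κ)`, then for all scaling data, every `N_f = 0` two-loop a.f. coupling sequence `β'` and
every block scale `ℓ₀ > 0`, `WilsonBetaLipschitz κ (η₀ / max 1 (afBeta 0 Λ' ℓ₀)) a L β' ℓ₀` holds: feed
`W ≡ 0` (admissible: `isReflectionPositive_zero_odd`, `normLE_zero`, (h4) vacuous) and compare in clause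
(iv) with the coupling shift `W' = t • wilson ρ₃ ⌊ℓ₀/a_k⌋` — admissible by §2 for
`0 ≤ t ≤ η / (288 e^{3κ} ⌊ℓ₀/a_k⌋⁴)` — whose perturbed Schwinger functions are the Wilson ones at
`β'_k + t` (`expectation_smul_wilson`). [folklore] -/
theorem robustYangMills_imp_betaLipschitz
    (hR : Summit.QuantumFields.QCD.Theses.NestedDissectionSea.RobustYangMills) :
    ∃ η₀ : ℝ, 0 < η₀ ∧ ∃ κ : ℝ, 0 ≤ κ ∧
      ∀ (a : ℕ → ℝ) (L : ℕ → ℕ) (ha : ∀ k, 0 < a k) (ha₀ : Filter.Tendsto a Filter.atTop (nhds 0))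
        (haL : Filter.Tendsto (fun k => a k * L k) Filter.atTop Filter.atTop) (β' : ℕ → ℝ) (Λ' : ℝ),
        0 < Λ' → Filter.Tendsto (fun k => β' k - afBeta 0 Λ' (a k)) Filter.atTop (nhds 0) →
          ∀ ℓ₀ : ℝ, 0 < ℓ₀ → WilsonBetaLipschitz κ (η₀ / max 1 (afBeta 0 Λ' ℓ₀)) a L ha ha₀ haL β' ℓ₀ := by
  obtain ⟨η₀, hη₀, κ, hκ, h⟩ := hR
  refine ⟨η₀, hη₀, κ, hκ, fun a L ha ha₀ haL β' Λ' hΛ' hβ' ℓ₀ hℓ₀ => ?_⟩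
  have h1 := h a L ha ha₀ haL β' Λ' hΛ' hβ' ℓ₀ hℓ₀
  have hη : 0 ≤ η₀ / max 1 (afBeta 0 Λ' ℓ₀) :=
    div_nonneg hη₀.le (le_trans zero_le_one (le_max_left _ _))
  have hpos : ∀ᶠ k in atTop, 0 ≤ β' k := eventually_nonneg_of_af ha ha₀ hΛ' hβ'
  have hL1 : ∀ᶠ k in atTop, 1 ≤ L k := by
    have h2 : ∀ᶠ k in atTop, (1 : ℝ) ≤ a k * L k := haL.eventually_ge_atTop 1
    have h3 : ∀ᶠ k in atTop, a k ≤ 1 := (ha₀.eventually (gt_mem_nhds one_pos)).mono fun k hk => hk.le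
    filter_upwards [h2, h3] with k hk hk'
    by_contra hcon
    push Not at hcon
    have : L k = 0 := by omega
    rw [this] at hk
    simp at hk
    linarith
  have hb1 : ∀ᶠ k in atTop, 0 < ⌊ℓ₀ / a k⌋₊ := by
    filter_upwards [ha₀.eventually (eventually_le_nhds hℓ₀)] with k hk
    exact Nat.floor_pos.2 ((one_le_div (ha k)).2 hk)
  obtain ⟨φ, hφ, c, m, T, Δ, hΔ, hconv, hnt, hng, hgapT, hgapL, hlip⟩ := h1 (fun k S => 0) (by
    filter_upwards [hpos, hL1] with k hk hkL S hS
    refine ⟨fun v U => by simp, fun U => by simp, fun π U => by simp,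
      isReflectionPositive_zero_odd ρ₃ (le_trans hkL hS) continuous_ρ₃ hk _,
      QuasiLocalGaugePerturbation.normLE_zero hη, ?_⟩
    rintro X - ⟨U, hU⟩
    simp at hU)
  refine ⟨φ, hφ, c, m, T, Δ, hΔ, fun n hn σ f F hF hF' => ?_, hnt, hng, hgapT, fun A B => ?_, fun n σ f => ?_⟩
  · have := hconv n hn σ f F hF hF'
    refine this.congr fun j => ?_
    exact congrArg (fun r : ℝ => (r : ℂ))
      (perturbedLatticeSchwinger_zero ρ₃
        (⟨a, ha, ha₀, β', L, haL, c, m⟩ : SpeciesScheme (YMSpecies SU3))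
        (bs := fun k => ⌊ℓ₀ / a k⌋₊) (fun s => s.F) (φ j) n σ f)
  · obtain ⟨C, hC⟩ := hgapL A B
    refine ⟨C, ?_⟩
    filter_upwards [hC] with k hk S hS n hn
    have := hk S hS n hn
    beta_reduce at this
    rwa [QuasiLocalGaugePerturbation.connectedCorr_zero] at this
  · obtain ⟨C, hC⟩ := hlip n σ f
    refine ⟨C, ?_⟩
    filter_upwards [hC, hpos, hL1, hb1] with k hk hβk hLk hbk t ht htη
    have e1 : perturbedLatticeSchwinger ρ₃ (⟨a, ha, ha₀, β', L, haL, c, m⟩ : SpeciesScheme (YMSpecies SU3))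
        (fun k' => (0 : QuasiLocalGaugePerturbation 4 (2 * L k' + 1) SU3 ⌊ℓ₀ / a k'⌋₊)) (fun s => s.F) k n σ f =
        latticeSchwinger ρ₃ (⟨a, ha, ha₀, β', L, haL, c, m⟩ : SpeciesScheme (YMSpecies SU3)) (fun s => s.F) k n σ f :=
      perturbedLatticeSchwinger_zero ρ₃ _ _ k n σ f
    have e2 : perturbedLatticeSchwinger ρ₃ (⟨a, ha, ha₀, β', L, haL, c, m⟩ : SpeciesScheme (YMSpecies SU3))
        (fun k' => t • QuasiLocalGaugePerturbation.wilson (d := 4) (L := 2 * L k' + 1) ρ₃ continuous_ρ₃ ⌊ℓ₀ / a k'⌋₊)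
        (fun s => s.F) k n σ f =
        latticeSchwinger ρ₃ (⟨a, ha, ha₀, fun k => β' k + t, L, haL, c, m⟩ : SpeciesScheme (YMSpecies SU3))
          (fun s => s.F) k n σ f := by
      simp only [perturbedLatticeSchwinger]
      erw [QuasiLocalGaugePerturbation.expectation_smul_wilson]
      rfl
    have key := hk (fun k' S => t • QuasiLocalGaugePerturbation.wilson ρ₃ continuous_ρ₃ ⌊ℓ₀ / a k'⌋₊)
      (fun S hS => ⟨fun v U => total_smul_wilson_shift ρ₃ continuous_ρ₃ _ t v U,
        fun U => total_smul_wilson_timeReflect ρ₃ continuous_ρ₃ _ t U,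
        fun π U => total_smul_wilson_perm ρ₃ continuous_ρ₃ _ t π U,
        isReflectionPositive_smul_wilson ρ₃ continuous_ρ₃ (le_trans hLk hS) _ (by linarith),
        (normLE_smul_wilson_su3 hκ hbk ht).mono htη,
        fun X _ hne y hy y' hy' i => rangeControl_smul_wilson ρ₃ continuous_ρ₃ hbk t X hne y hy y' hy' i⟩)
      (t * (288 * Real.exp (3 * κ) * (⌊ℓ₀ / a k⌋₊ : ℝ) ^ 4)) (by positivity)
      (fun S hS => by
        have := (QuasiLocalGaugePerturbation.normLE_zero le_rfl).sub
          (normLE_smul_wilson_su3 (Lt := 2 * S + 1) hκ hbk ht (t := t))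
        rwa [zero_add] at this)
    beta_reduce at key
    rw [e1, e2] at key
    exact key

end SU3Shift

end Summit.QuantumFields.QCD.Theorems.RobustYangMills.Negative

end
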